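import Summits.AtomisticToContinuum.Crystallization.Theses.OneCentreSteepnessLadder

/-!
# RungAssembly — glue for the Mie rung of route OneCentreSteepnessLadder

Closes item stmt-AtomisticToContinuum-12888 (`RungAssembly`): the composition
`LadderDomination → LadderGroundStates → ZeroDensityOfDefects → ExactificationCascade →
DominationEnergyLimit → MieRung`.  Pure bookkeeping: take `q ≥ max (max q₀ q₁) 4`,
`δ := 1 - 2/q > 0`, and instantiate the three `∀ q`-support lemmas at `(q, δ, a, h)`.
-/

namespace Summit.AtomisticToContinuum.Crystallization.Theorems

open Summit.AtomisticToContinuum.Crystallization.Theses.OneCentreSteepnessLadder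

/-- **Rung assembly** (item stmt-AtomisticToContinuum-12888).  Given the ladder engine
(`LadderDomination`, threshold `q₀`), existence and `(1 - 2/q)`-separation of Mie ground states
(`LadderGroundStates`, threshold `q₁`) and the three `q`-uniform support lemmas, the Mie rung
`MieRung` holds with threshold `max (max q₀ q₁) 4`: for such `q` put `δ := 1 - 2/q > 0` and apply
`ZeroDensityOfDefects`, then `ExactificationCascade` (crystallization) and
`DominationEnergyLimit` (periodic ground-state energy). -/
theorem rungAssembly_proof : RungAssembly := by
  unfold RungAssembly
  intro hLad hGS hZ hEx hE
  obtain ⟨q₀, hq₀⟩ := hLad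
  obtain ⟨q₁, hq₁⟩ := hGS
  refine ⟨max (max q₀ q₁) 4, fun q hq => ?_⟩
  have hq0 : q₀ ≤ q := le_trans (le_trans (le_max_left _ _) (le_max_left _ _)) hq
  have hq1 : q₁ ≤ q := le_trans (le_trans (le_max_right _ _) (le_max_left _ _)) hq
  have hq4 : 4 ≤ q := le_trans (le_max_right _ _) hq
  obtain ⟨a, h, ha, hh, hw₁, hw₂, hdom⟩ := hq₀ q hq0
  obtain ⟨hex, hsep⟩ := hq₁ q hq1
  have hδ : (0 : ℝ) < 1 - 2 / (q : ℝ) := by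
    have hq4' : (4 : ℝ) ≤ (q : ℝ) := by exact_mod_cast hq4
    rw [sub_pos, div_lt_one (by linarith)]
    linarith
  have hzd := hZ q hq4 (1 - 2 / (q : ℝ)) a h hδ ha hh hsep hdom
  have hcr := hEx q hq4 (1 - 2 / (q : ℝ)) a h hδ ha hh hw₁ hw₂ hsep hzd
  have hen := hE q hq4 (1 - 2 / (q : ℝ)) a h hδ ha hh hex hsep hdom
  exact ⟨hen, hcr⟩

end Summit.AtomisticToContinuum.Crystallization.Theorems
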